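import Mathlib
import HarnessLib
import Summits.ValiantsHypothesis.ValiantsHypothesis.Theses.NewtonUnitEquations
import Summits.ValiantsHypothesis.ValiantsHypothesis.Theses.NewtonFrames
import Literature.Computability.AlgebraicComplexity.NewtonPolygonTauTransfer

/-!
# Route NewtonUnitEquations — support item `KpttTransfer` (KPTT 2015, Theorem 1)

The support item `KpttTransfer` of route `NewtonUnitEquations` (also wanted by route
`NewtonFrames`) states, with the weak Newton-polygon τ-conjecture inlined as hypothesis:

  the bound `#vertices Newt(Σ_{i<k} Π_{j<m} f_ij) ≤ 2^{a·m} · (kt+2)^b` for all `t`-sparse bivariate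
  `f_ij` over `ℂ` implies that `(per_n)_n` is not a VP family over `ℂ`.

This is Theorem 1 of Koiran–Portier–Tavenas–Thomassé, *A τ-conjecture for Newton polygons*
(Found. Comput. Math. 15 (2015), arXiv:1308.2286), in its weak-form instance, and it is already
discharged in the tree as the Literature fact
`Literature.Computability.AlgebraicComplexity.KPTT.theorem1_holds`
(`Literature/Computability/AlgebraicComplexity/NewtonPolygonTauTransfer.lean`), whose statement
`KPTT.theorem1 : newtonTauWeak → ¬ IsVPFamily (fun n => perPoly (Fin n) ℂ)` is the route decl
verbatim once the abbreviation `newtonVertexCount` is unfolded. The proof below is that one line.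
-/

-- `<Problem> = <Summit>` for this single-conjunct summit (lakefile sets the same option tree-wide).
set_option linter.dupNamespace false

namespace Summit.ValiantsHypothesis.ValiantsHypothesis.Theorems

open Literature.Computability.AlgebraicComplexity

/-- **KPTT 2015, Theorem 1 (weak form)** closes the support item `KpttTransfer` of route
`NewtonUnitEquations`: the weak Newton-polygon τ-conjecture (`2^{O(m)}(kt)^{O(1)}` vertices for
sums of `k` products of `m` `t`-sparse bivariate polynomials over `ℂ`) implies that the permanent
family is not a VP family over `ℂ`. Proof: the in-tree discharge `KPTT.theorem1_holds`
(witness `W_n = Σ_{i<2^n} X^i Y^{2i(2^n-1-i)}`, a projection of Tavenas' `hV`, combined with the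
`n^{O(√n)}` depth-four reduction). -/
theorem kpttTransfer_proof :
    Summit.ValiantsHypothesis.ValiantsHypothesis.Theses.NewtonUnitEquations.KpttTransfer := by
  unfold Summit.ValiantsHypothesis.ValiantsHypothesis.Theses.NewtonUnitEquations.KpttTransfer
  exact KPTT.theorem1_holds

/-- The same closure for the sibling route `NewtonFrames`, whose support item `KpttTransfer` is the
same ledger item with the byte-identical statement: KPTT 2015, Theorem 1 (weak form), by the
in-tree discharge `KPTT.theorem1_holds`. -/
theorem newtonFrames_kpttTransfer_proof :
    Summit.ValiantsHypothesis.ValiantsHypothesis.Theses.NewtonFrames.KpttTransfer := by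
  unfold Summit.ValiantsHypothesis.ValiantsHypothesis.Theses.NewtonFrames.KpttTransfer
  exact KPTT.theorem1_holds

end Summit.ValiantsHypothesis.ValiantsHypothesis.Theorems
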